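import Summits.QuantumFields.BalabanUV.Beta.EriceRemainderEnclosureHistoryAutonomyComparisonAgeCompositionThreeAgesDefectMonotone

/-!
# EriceRemainderEnclosureHistoryAutonomyComparisonAgeCompositionThreeAgesDefectProductForm — (E87r) route (N), first order, THREE loaded ages: the
# damping-free inequality (★h°) of (E87o)∕(E87p) (SUM-structured) FROM THE PRODUCT FORM «v5» of README g78/e87 §4 — one inequality per pin `m` and number
# of entering lags `J ≤ k₂`: `r·J·q_{m+1+k₃} ≤ Pf(m+1,m+k₃)·S(m+1)·(r·q_{m+1} + (1−r)·Σ_{l' ≤ k₃−k₂+J} Π_{t∈[m+1,m+l']}(1+F_t)·q_{m+1+l'})`, `S(p)` the complete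
# young floor row per unit coefficient — by the depth monotonicity of `S` ((E87q) `youngFloorRow_mono`)

Cell `pub-balaban`, β-function sub-cell, BINDER row D4 «RemainderConst leaves for Bałaban's split» (`HOME/BINDER-OWNERS.md`; owner lineage `b2b-balaban-beta-an4`;
this file by co-owner #2 lineage `b2b-balaban-beta-d4-p2`, generation 78), β-FLOW TEAM duty (1), FREEZE (0) honoured (def-free; imports (E87q); uses (E87q)
`youngFloorRow_mono` BY NAME; nothing restated).

HONEST FRAMING (page 1, verbatim and binding).  *"Discharging BetaPertH makes Bałaban's UV stability UNCONDITIONAL — a real constructive-QFT result; it is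
NOT the continuum limit and NOT the Clay problem."*  THIS FILE DISCHARGES NOTHING OF THE KIND.  Elementary real analysis about ABSTRACT functionals on a box
]0,γ]^ℕ with displayed floors, profiles and signs — hypotheses of a census, not facts; the form, signs, ages and moments of Bałaban's (1.22) limit functional
are NOT PRINTED ([I] p. 298; GAPS G-t4-U2-1∕-2) and NOT asserted.  Row D4 class UNCHANGED (critical-path width 0; instance 0∕1; D4 DISCHARGE NO DATE).
HONEST DEPENDENCY: continuum YM on T⁴ ⇐ BetaPertH ∧ nine spine estimates (0/9 proved); BetaPertH ⇐ (D1) ∧ (D4) ∧ CAP+tail; G-an2-4 gates asym, D1 and NE2/3/4.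

THE POINT (census sense (α); route (N); README `HOME/b2b-balaban-beta-d4-p2/g78/e87/README.md` §4 (1)).  **`product_abs_of_v5`**: at a pin `m`, (★h°) for EVERY
truncation `j ≥ m+1+k₃` (the hypothesis `hprod` of (E87o) `static_defect_abs_of_product` ∕ (E87p) `flow_nonneg_three_ages_of_product_abs`) from the
PRODUCT-FORM inequalities «v5_J», `1 ≤ J ≤ k₂`: `r·J·q_{m+1+k₃} ≤ Pf(m+1,m+k₃)·S(m+1)·(r·q_{m+1} + (1−r)·Σ_{l'<k₃} [l' ≤ k₃−k₂+J]·Π_{t∈[m+1,m+1+l')}(1+F_t)·q_{m+1+l'})`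
with `S(p) = Σ_{l<k₂} Pf(p+1+l,p+k₂)·τlo(p+1+l)` and `r = (h_{m+k₃+1}∕h_{m+k₃})³` — the truncation with `J` entering lags keeps the young rows `m+1+l'`, `l' ≤
k₃−k₂+J`, complete, each at least `q_{m+1+l'}·S(m+1)` ((E87q) `youngFloorRow_mono`), and `Pf(m+1+l',m+k₃) = Pf(m+1,m+k₃)·Π_{[m+1,m+1+l')}(1+F)`.  Bench (README §4,
kit j335932∕j335940; `J = k₂`, the hardest): v5 log-margin `−0.55∕−0.38∕−0.26∕−0.20∕−0.17∕−0.19` (k₃ = 8∕16∕32∕64∕128∕256), its linearised budget `≥ +0.10`.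
NOT CLAIMED: v5 along flows (successor); anything nonlinear; anything printed — NOT B12 Thm 2, NOT BetaPertH.

WHAT IS PROVED ([folklore]; 0 `def`, 0 sorry).  `floorRow_mono_iter` (iterate of (E87q) §4), `floorProd_split`, **`product_abs_of_v5`**.
-/
noncomputable section
open Finset

namespace Summit.QuantumFields.BalabanUV.Beta.EriceRemainderEnclosureHistoryAutonomyComparisonAgeCompositionThreeAgesDefectProductForm

open Literature.MathematicalPhysics.QuantumFieldTheory.Balaban1983to89
open Literature.MathematicalPhysics.QuantumFieldTheory.Balaban1983to89.T4BetaStationary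
open Literature.MathematicalPhysics.QuantumFieldTheory.Balaban1983to89.T4BetaFlowWellPosed
open Summit.QuantumFields.BalabanUV.Beta.EriceRemainderEnclosureHistoryAutonomyOrder (strictAnti_of_memFlow)
open Summit.QuantumFields.BalabanUV.Beta.EriceRemainderEnclosureHistoryAutonomyComparisonAgeCompositionThreeAgesDefectMonotone (youngFloorRow_mono)

variable {B : (ℕ → ℝ) → ℝ} {γ b gIR : ℝ} {L : ℕ → ℝ} {K : ℕ} {h : ℕ → ℝ}

/-- Iterate of (E87q) `youngFloorRow_mono`: the complete young floor row does not decrease from the pin `p ≥ 1` to any deeper pin `p + d`. [folklore] -/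
theorem floorRow_mono_iter (hmono : ∀ u v : ℕ → ℝ, SeqBox γ u → SeqBox γ v → (∀ j, u j ≤ v j) → B u ≤ B v)
    (hL : ∀ k, 0 ≤ L k) (hb : 0 < b) (hlo : ∀ u, SeqBox γ u → b ≤ B u) (hdom : ∀ u, SeqBox γ u → ∑ k ∈ range K, L k * u k ≤ B u)
    (hh : SeqBox γ h) (hf : MemFlow B gIR h)
    {k₂ k₃ : ℕ} (hk2 : 2 ≤ k₂) (hk23 : k₂ < k₃) (hk3K : k₃ < K)
    {q c F ρUp τlo : ℕ → ℝ} {Pf : ℕ → ℕ → ℝ} (hq : ∀ n, q n = L k₂ * h (n + k₂) ^ 3 / 2) (hc : ∀ n, c n = L k₃ * h (n + k₃) ^ 3 / 2)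
    (hF : ∀ t, F t = ∑ j ∈ range K, L j * h (t + j) ^ 3 / 2) (hPf : ∀ a b, Pf a b = (∏ t ∈ Ico a (b + 1), (1 + F t))⁻¹)
    (hρUp : ∀ p, ρUp p = (k₂ * q p) * (1 + (1 - (h (p + k₃ + k₂) / h (p + k₃)) ^ 3 * (∏ t ∈ Ico (p + k₃ + 1) (p + k₃ + k₂ + 1), (1 + F t))⁻¹) *
      ((k₃ * c p) / (1 - k₃ * c p))) / (1 - k₂ * c p))
    (hτlo : ∀ p', τlo p' = max (max ((1 - ρUp p') * (1 - k₃ * c p')) (1 - k₃ * c p' - k₂ * q p')) 0)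
    {S : ℕ → ℝ} (hS : ∀ p, S p = ∑ l ∈ range k₂, Pf (p + 1 + l) (p + k₂) * τlo (p + 1 + l))
    {p : ℕ} (hp : 1 ≤ p) (d : ℕ) : S p ≤ S (p + d) := by
  induction d with
  | zero => simp
  | succ d ih =>
    refine ih.trans ?_
    rw [hS, hS, show p + (d + 1) = p + d + 1 by ring]
    have h1 := youngFloorRow_mono hmono hL hb hlo hdom hh hf hk2 hk23 hk3K hq hc hF hPf hρUp hτlo (p := p + d) (by omega)
    simpa only [show p + d + 2 = p + d + 1 + 1 by ring, add_assoc, add_comm, add_left_comm] using h1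

/-- The floor products split: `Pf(m+1+l', m+k₃) = Pf(m+1, m+k₃)·Π_{t∈[m+1,m+1+l')}(1+F_t)` for `l' < k₃`. [folklore] -/
theorem floorProd_split {F : ℕ → ℝ} (hF0 : ∀ t, 0 ≤ F t) {Pf : ℕ → ℕ → ℝ} (hPf : ∀ a b, Pf a b = (∏ t ∈ Ico a (b + 1), (1 + F t))⁻¹)
    {m k₃ l' : ℕ} (hl' : l' < k₃) : Pf (m + 1 + l') (m + k₃) = Pf (m + 1) (m + k₃) * ∏ t ∈ Ico (m + 1) (m + 1 + l'), (1 + F t) := by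
  rw [hPf, hPf, ← prod_Ico_consecutive (f := fun t => 1 + F t) (show m + 1 ≤ m + 1 + l' by omega) (show m + 1 + l' ≤ m + k₃ + 1 by omega)]
  have hne : ∏ t ∈ Ico (m + 1) (m + 1 + l'), (1 + F t) ≠ 0 := (prod_pos fun t _ => by have := hF0 t; linarith).ne'
  rw [mul_inv, mul_comm (∏ t ∈ Ico (m + 1) (m + 1 + l'), (1 + F t))⁻¹, mul_assoc, inv_mul_cancel₀ hne, mul_one]

/-- **(★h°) AT A PIN FROM THE PRODUCT FORM «v5».**  Setting of (E87q) (three-age flow; `q`, `c`, `F`, `Pf`, `ρUp`, `τlo` displayed), `S(p)` the complete young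
floor row per unit coefficient, `ALa_j(p) = q_p·Σ_l [p+1+l ≤ j]·Pf(p+1+l,p+k₂)·τlo(p+1+l)`, `r = (h_{m+k₃+1}∕h_{m+k₃})³`.  IF for every `1 ≤ J ≤ k₂`
**«v5_J»** `r·J·q_{m+1+k₃} ≤ Pf(m+1,m+k₃)·S(m+1)·(r·q_{m+1} + (1−r)·Σ_{l'<k₃} [l' ≤ k₃−k₂+J]·Π_{t∈[m+1,m+1+l')}(1+F_t)·q_{m+1+l'})`, THEN (★h°) holds at `m` for
every truncation `j ≥ m+1+k₃` (the `hprod` of (E87o)∕(E87p)). [folklore] -/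
theorem product_abs_of_v5 (hmono : ∀ u v : ℕ → ℝ, SeqBox γ u → SeqBox γ v → (∀ j, u j ≤ v j) → B u ≤ B v)
    (hL : ∀ k, 0 ≤ L k) (hb : 0 < b) (hlo : ∀ u, SeqBox γ u → b ≤ B u) (hdom : ∀ u, SeqBox γ u → ∑ k ∈ range K, L k * u k ≤ B u)
    (hh : SeqBox γ h) (hf : MemFlow B gIR h)
    {k₂ k₃ : ℕ} (hk2 : 2 ≤ k₂) (hk23 : k₂ < k₃) (hk3K : k₃ < K)
    {q c F ρUp τlo : ℕ → ℝ} {Pf ALa : ℕ → ℕ → ℝ} (hq : ∀ n, q n = L k₂ * h (n + k₂) ^ 3 / 2) (hc : ∀ n, c n = L k₃ * h (n + k₃) ^ 3 / 2)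
    (hF : ∀ t, F t = ∑ j ∈ range K, L j * h (t + j) ^ 3 / 2) (hPf : ∀ a b, Pf a b = (∏ t ∈ Ico a (b + 1), (1 + F t))⁻¹)
    (hρUp : ∀ p, ρUp p = (k₂ * q p) * (1 + (1 - (h (p + k₃ + k₂) / h (p + k₃)) ^ 3 * (∏ t ∈ Ico (p + k₃ + 1) (p + k₃ + k₂ + 1), (1 + F t))⁻¹) *
      ((k₃ * c p) / (1 - k₃ * c p))) / (1 - k₂ * c p))
    (hτlo : ∀ p', τlo p' = max (max ((1 - ρUp p') * (1 - k₃ * c p')) (1 - k₃ * c p' - k₂ * q p')) 0)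
    (hALa : ∀ j p, ALa j p = q p * ∑ l ∈ range k₂, if p + 1 + l ≤ j then Pf (p + 1 + l) (p + k₂) * τlo (p + 1 + l) else 0)
    {S : ℕ → ℝ} (hS : ∀ p, S p = ∑ l ∈ range k₂, Pf (p + 1 + l) (p + k₂) * τlo (p + 1 + l))
    {m : ℕ}
    (hv5 : ∀ J, 1 ≤ J → J ≤ k₂ →
      (h (m + k₃ + 1) / h (m + k₃)) ^ 3 * J * q (m + 1 + k₃) ≤ Pf (m + 1) (m + k₃) * S (m + 1) *
        ((h (m + k₃ + 1) / h (m + k₃)) ^ 3 * q (m + 1) +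
          (1 - (h (m + k₃ + 1) / h (m + k₃)) ^ 3) * ∑ l' ∈ range k₃, if l' ≤ k₃ - k₂ + J then (∏ t ∈ Ico (m + 1) (m + 1 + l'), (1 + F t)) * q (m + 1 + l') else 0)) :
    ∀ j, m + 1 + k₃ ≤ j →
      (h (m + k₃ + 1) / h (m + k₃)) ^ 3 * q (m + 1 + k₃) * (∑ l ∈ range k₂, if m + 2 + k₃ + l ≤ j then (1:ℝ) else 0) ≤
        (1 - (h (m + k₃ + 1) / h (m + k₃)) ^ 3) * ∑ l' ∈ range k₃, Pf (m + 1 + l') (m + k₃) * ALa j (m + 1 + l') +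
          (h (m + k₃ + 1) / h (m + k₃)) ^ 3 * (Pf (m + 1) (m + k₃) * ALa j (m + 1)) := by
  intro j hj
  have hpos : ∀ n, 0 < h n := fun n => (hh n).1
  have hanti := (strictAnti_of_memFlow hb hlo hh hf).antitone
  have hF0 : ∀ t, 0 ≤ F t := fun t => by
    rw [hF]; exact sum_nonneg fun j _ => by have := hL j; have := hpos (t + j); positivity
  have hq0 : ∀ n, 0 ≤ q n := fun n => by rw [hq]; have := hL k₂; have := hpos (n + k₂); positivity
  have hPf0 : ∀ a b, 0 ≤ Pf a b := fun a b => by rw [hPf]; exact inv_nonneg.mpr (prod_nonneg fun t _ => by have := hF0 t; positivity)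
  have hτ0 : ∀ p', 0 ≤ τlo p' := fun p' => by rw [hτlo]; exact le_max_right _ _
  have hS0 : ∀ p, 0 ≤ S p := fun p => by rw [hS]; exact sum_nonneg fun l _ => mul_nonneg (hPf0 _ _) (hτ0 _)
  set r : ℝ := (h (m + k₃ + 1) / h (m + k₃)) ^ 3 with hr
  have hr0 : 0 ≤ r := by have := hpos (m + k₃ + 1); have := hpos (m + k₃); positivity
  have hr1 : r ≤ 1 := pow_le_one₀ (div_nonneg (hpos _).le (hpos _).le) ((div_le_one (hpos _)).mpr (hanti (by omega)))
  have hALa0 : ∀ p, 0 ≤ ALa j p := fun p => by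
    rw [hALa]; exact mul_nonneg (hq0 p) (sum_nonneg fun l _ => by split_ifs <;> [exact mul_nonneg (hPf0 _ _) (hτ0 _); exact le_rfl])
  -- the number of entering lags J and the count on the left
  obtain ⟨J, rfl⟩ : ∃ J, j = m + 1 + k₃ + J := ⟨j - (m + 1 + k₃), by omega⟩
  have hcount : (∑ l ∈ range k₂, if m + 2 + k₃ + l ≤ m + 1 + k₃ + J then (1:ℝ) else 0) = ((min J k₂ : ℕ) : ℝ) := by
    rw [sum_ite, sum_const_zero, add_zero, sum_const, nsmul_eq_mul, mul_one]
    congr 1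
    rw [show (range k₂).filter (fun l => m + 2 + k₃ + l ≤ m + 1 + k₃ + J) = range (min J k₂) from ?_, card_range]
    ext l; simp only [mem_filter, mem_range, lt_min_iff]; omega
  rw [hcount]
  rcases Nat.eq_zero_or_pos J with hJ0 | hJpos
  · -- no entering lag reads below the edge: the left side vanishes
    subst hJ0
    rw [show min 0 k₂ = 0 by simp, Nat.cast_zero, mul_zero]
    have h1 : 0 ≤ (1 - r) * ∑ l' ∈ range k₃, Pf (m + 1 + l') (m + k₃) * ALa (m + 1 + k₃ + 0) (m + 1 + l') :=
      mul_nonneg (by linarith) (sum_nonneg fun l' _ => mul_nonneg (hPf0 _ _) (hALa0 _))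
    have h2 : 0 ≤ r * (Pf (m + 1) (m + k₃) * ALa (m + 1 + k₃ + 0) (m + 1)) := mul_nonneg hr0 (mul_nonneg (hPf0 _ _) (hALa0 _))
    linarith
  -- J' = min J k₂ entering lags; the complete young rows l' ≤ k₃ − k₂ + J'
  set J' : ℕ := min J k₂ with hJ'
  have hJ'1 : 1 ≤ J' := le_min hJpos (by omega)
  have hJ'2 : J' ≤ k₂ := min_le_right _ _
  -- complete rows: for l' ≤ k₃ - k₂ + J', ALa_j(m+1+l') = q·S(m+1+l') ≥ q_{m+1+l'}·S(m+1)
  have hrow : ∀ l', l' < k₃ → l' ≤ k₃ - k₂ + J' → q (m + 1 + l') * S (m + 1) ≤ ALa (m + 1 + k₃ + J) (m + 1 + l') := by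
    intro l' hl' hcut
    have hfull : ALa (m + 1 + k₃ + J) (m + 1 + l') = q (m + 1 + l') * S (m + 1 + l') := by
      rw [hALa, hS]; congr 1
      exact sum_congr rfl fun l hl => by
        have := mem_range.mp hl
        have hJJ : J' ≤ J := min_le_left _ _
        rw [if_pos (by omega)]
    rw [hfull]
    exact mul_le_mul_of_nonneg_left (floorRow_mono_iter hmono hL hb hlo hdom hh hf hk2 hk23 hk3K hq hc hF hPf hρUp hτlo hS (p := m + 1) (by omega) l')
      (hq0 _)
  -- the right side from below by the product form
  have hD : Pf (m + 1) (m + k₃) * S (m + 1) * ∑ l' ∈ range k₃, (if l' ≤ k₃ - k₂ + J' then (∏ t ∈ Ico (m + 1) (m + 1 + l'), (1 + F t)) * q (m + 1 + l') else 0) ≤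
      ∑ l' ∈ range k₃, Pf (m + 1 + l') (m + k₃) * ALa (m + 1 + k₃ + J) (m + 1 + l') := by
    rw [mul_sum]
    refine sum_le_sum fun l' hl' => ?_
    have hl'k := mem_range.mp hl'
    split_ifs with hcut
    · rw [floorProd_split hF0 hPf hl'k]
      have := hrow l' hl'k hcut
      have hP0 : 0 ≤ Pf (m + 1) (m + k₃) * ∏ t ∈ Ico (m + 1) (m + 1 + l'), (1 + F t) :=
        mul_nonneg (hPf0 _ _) (prod_nonneg fun t _ => by have := hF0 t; positivity)
      calc Pf (m + 1) (m + k₃) * S (m + 1) * ((∏ t ∈ Ico (m + 1) (m + 1 + l'), (1 + F t)) * q (m + 1 + l'))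
          = (Pf (m + 1) (m + k₃) * ∏ t ∈ Ico (m + 1) (m + 1 + l'), (1 + F t)) * (q (m + 1 + l') * S (m + 1)) := by ring
        _ ≤ (Pf (m + 1) (m + k₃) * ∏ t ∈ Ico (m + 1) (m + 1 + l'), (1 + F t)) * ALa (m + 1 + k₃ + J) (m + 1 + l') :=
          mul_le_mul_of_nonneg_left this hP0
    · rw [mul_zero]; exact mul_nonneg (hPf0 _ _) (hALa0 _)
  have hE : Pf (m + 1) (m + k₃) * S (m + 1) * q (m + 1) ≤ Pf (m + 1) (m + k₃) * ALa (m + 1 + k₃ + J) (m + 1) := by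
    have := hrow 0 (by omega) (by omega)
    rw [add_zero] at this
    calc Pf (m + 1) (m + k₃) * S (m + 1) * q (m + 1) = Pf (m + 1) (m + k₃) * (q (m + 1) * S (m + 1)) := by ring
      _ ≤ Pf (m + 1) (m + k₃) * ALa (m + 1 + k₃ + J) (m + 1) := mul_le_mul_of_nonneg_left this (hPf0 _ _)
  have hv := hv5 J' hJ'1 hJ'2
  have h1 := mul_le_mul_of_nonneg_left hD (by linarith : (0:ℝ) ≤ 1 - r)
  have h2 := mul_le_mul_of_nonneg_left hE hr0
  calc r * q (m + 1 + k₃) * (J' : ℝ) = r * J' * q (m + 1 + k₃) := by ring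
    _ ≤ Pf (m + 1) (m + k₃) * S (m + 1) * (r * q (m + 1) +
          (1 - r) * ∑ l' ∈ range k₃, if l' ≤ k₃ - k₂ + J' then (∏ t ∈ Ico (m + 1) (m + 1 + l'), (1 + F t)) * q (m + 1 + l') else 0) := hv
    _ = r * (Pf (m + 1) (m + k₃) * S (m + 1) * q (m + 1)) +
          (1 - r) * (Pf (m + 1) (m + k₃) * S (m + 1) *
            ∑ l' ∈ range k₃, if l' ≤ k₃ - k₂ + J' then (∏ t ∈ Ico (m + 1) (m + 1 + l'), (1 + F t)) * q (m + 1 + l') else 0) := by ring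
    _ ≤ r * (Pf (m + 1) (m + k₃) * ALa (m + 1 + k₃ + J) (m + 1)) +
          (1 - r) * ∑ l' ∈ range k₃, Pf (m + 1 + l') (m + k₃) * ALa (m + 1 + k₃ + J) (m + 1 + l') := by linarith
    _ = _ := by ring

end Summit.QuantumFields.BalabanUV.Beta.EriceRemainderEnclosureHistoryAutonomyComparisonAgeCompositionThreeAgesDefectProductForm

end
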